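import Mathlib.RingTheory.Grassmannian
import Mathlib.Algebra.Module.LocalizedModule.Submodule
import Mathlib.RingTheory.Localization.BaseChange
import Mathlib.LinearAlgebra.TensorProduct.RightExactness
import HarnessLib

/-!
# `Module.Grassmannian.map` along an algebra map is the span of the image; along a localization it is `localized'`

Topic `AlgebraicGeometry/Motives`; namespace `Literature.AlgebraicGeometry.Motives.Grassmannian`.
THEOREMS ONLY (no definition, no named fact, no instance, no `sorry`); Mathlib-only imports.

Mathlib's Grassmannian functor `Module.Grassmannian.functor R M k : CommAlgCat R ⥤ Type` sends `φ : A → B` to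
`Module.Grassmannian.map φ`, defined as the KERNEL of `B ⊗[R] M ≃ B ⊗[A] (A ⊗[R] M) → B ⊗[A] ((A ⊗[R] M) ⧸ N)`.  By right
exactness of `B ⊗[A] –` (Mathlib `lTensor_mkQ`) this kernel is the `B`-span of the image of `N` under `φ ⊗ 1 : A ⊗[R] M →
B ⊗[R] M` ([GortzWedhorn2020, (8.4) pp. 213–215 and (8.6) p. 217, «`u ⊗ id_B`»], [StacksProject 089R/00EO]); when `B` is a localization of `A` at a
submonoid `S`, it is therefore the LOCALIZED submodule `N.localized'` of Mathlib's local-global API — which is the form in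
which Zariski gluing (★ `GrassmannianZariskiSheaf`) and separation (Mathlib `Submodule.eq_of_isLocalized'_span`) are stated.

* §1 `cancelBaseChange_one_tmul` — `cancelBaseChange R A B B M (1 ⊗ₜ x) = (φ ⊗ 1) x`;
  `restrictScalars_ker_mkQ_baseChange` — `ker (mkQ ⊗ B) = N.baseChange B` (right exactness);
* §2 **`map_toSubmodule_eq_span`** — `(map φ N).toSubmodule = span B ((φ ⊗ 1) '' N)` for ANY algebra map `φ`;
* §3 **`map_toSubmodule_eq_localized'`** — for `B` a localization of `A` at `S`:
  `(map φ N).toSubmodule = N.toSubmodule.localized' B S (φ ⊗ 1)` (the map `φ ⊗ 1 = AlgebraTensorModule.rTensor R M (Algebra.linearMap A B)`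
  is a localization of `A`-modules, Mathlib `IsLocalizedModule.rTensor`).

Cell `hodgecm-mathlib` (D-0151), F-DAG first hand (h4) «Grassmannian as a scheme» (B-p21 (g15) author, B-p18 (g17) partner),
count-neutral Mathlib-side capital (brick (Z0)).  Nothing here is about HC; HC_CM is proved only modulo the 7 printed
citations until rung 0 closes.

## References
* [GortzWedhorn2020] U. Görtz, T. Wedhorn, *Algebraic Geometry I*, 2nd ed. (2020), (8.4) (pp. 213–215) and (8.6) (p. 217) (the Grassmannian
  functor is a Zariski sheaf), Thm. 7.12 (p. 185) with Cor. 7.17 (p. 188) (quasi-coherent modules on standard opens).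
* [StacksProject] The Stacks project, Tag 089R (Grassmannians) and Tag 00EO (the sheaf `M̃`).
-/

namespace Literature.AlgebraicGeometry.Motives.Grassmannian

open TensorProduct

section

universe u v w

-- `Module.Grassmannian.map` asks the two algebras to live in one universe (Mathlib), hence `A B : Type w` below.
variable {R : Type u} [CommRing R] {M : Type v} [AddCommGroup M] [Module R M]
  {A B : Type w} [CommRing A] [Algebra R A] [CommRing B] [Algebra R B]
  [Algebra A B] [IsScalarTower R A B]

/-! ## §1 Plumbing: `cancelBaseChange` on `1 ⊗ x`, and the kernel of `mkQ ⊗ B` -/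

/-- `cancelBaseChange R A B B M (1 ⊗ₜ x) = (φ ⊗ 1) x` where `φ ⊗ 1 : A ⊗[R] M → B ⊗[R] M` is the base change of the
structure map `φ : A → B` (on pure tensors `1 ⊗ (a ⊗ m) ↦ φ a ⊗ m`). [cite: GortzWedhorn2020, (8.4) (pp. 213–215) and (8.6) (p. 217)] -/
theorem cancelBaseChange_one_tmul (x : A ⊗[R] M) :
    AlgebraTensorModule.cancelBaseChange R A B B M ((1 : B) ⊗ₜ[A] x) =
      AlgebraTensorModule.rTensor R M (Algebra.linearMap A B) x := by
  induction x using TensorProduct.induction_on with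
  | zero => simp
  | tmul a m =>
    rw [AlgebraTensorModule.cancelBaseChange_tmul, AlgebraTensorModule.rTensor_tmul, Algebra.linearMap_apply,
      Algebra.smul_def, mul_one]
  | add x y hx hy => rw [tmul_add, map_add, map_add, hx, hy]

omit [Algebra R B] [IsScalarTower R A B] in
/-- **Right exactness: `ker (mkQ ⊗_A B) = N.baseChange B`** in `B ⊗[A] (A ⊗[R] M)` (Mathlib `lTensor_mkQ` read for the
`B`-linear base change; `Submodule.baseChange` is by definition the range of `N.subtype ⊗ B`). [cite: StacksProject, Tag 00EO] -/
theorem ker_mkQ_baseChange_eq_baseChange (N : Submodule A (A ⊗[R] M)) :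
    LinearMap.ker (N.mkQ.baseChange B) = N.baseChange B := by
  apply Submodule.restrictScalars_injective A
  ext x
  change N.mkQ.baseChange B x = 0 ↔ x ∈ (N.baseChange B).restrictScalars A
  have h1 : N.mkQ.baseChange B x = LinearMap.lTensor B N.mkQ x :=
    congrFun (LinearMap.baseChange_eq_ltensor (A := B) N.mkQ) x
  rw [h1, ← LinearMap.mem_ker, lTensor_mkQ, Submodule.restrictScalars_mem, Submodule.baseChange]
  change x ∈ LinearMap.range (LinearMap.lTensor B N.subtype) ↔ x ∈ LinearMap.range (N.subtype.baseChange B)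
  constructor
  · rintro ⟨y, rfl⟩
    exact ⟨y, (congrFun (LinearMap.baseChange_eq_ltensor (A := B) N.subtype) y)⟩
  · rintro ⟨y, rfl⟩
    exact ⟨y, (congrFun (LinearMap.baseChange_eq_ltensor (A := B) N.subtype) y).symm⟩

/-! ## §2 `map φ N` is the span of the image of `N` -/

end

section Map

universe u' v' w'

variable {R : Type u'} [CommRing R] {M : Type v'} [AddCommGroup M] [Module R M] {k : ℕ}
  {A B : Type w'} [CommRing A] [Algebra R A] [CommRing B] [Algebra R B]

/-- **`(map φ N).toSubmodule = span_B ((φ ⊗ 1)(N))`** for an `R`-algebra map `φ : A → B`: Mathlib defines `map φ N` as the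
kernel of `B ⊗[R] M ≃ B ⊗[A] (A ⊗[R] M) → B ⊗[A] ((A ⊗[R] M) ⧸ N)`; by right exactness that kernel is `N.baseChange B`
transported along `cancelBaseChange`, i.e. the `B`-span of `(φ ⊗ 1)(N)` ([GortzWedhorn2020, (8.4) and (8.6)]: the Grassmannian
functor acts by `u ⊗ id`). [cite: GortzWedhorn2020, (8.4) (pp. 213–215) and (8.6) (p. 217)] [cite: StacksProject, Tag 089R] -/
theorem map_toSubmodule_eq_span (φ : A →ₐ[R] B) (N : Module.Grassmannian A (A ⊗[R] M) k) :
    (Module.Grassmannian.map φ N).toSubmodule =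
      Submodule.span B (φ.toLinearMap.rTensor M '' (N.toSubmodule : Set (A ⊗[R] M))) := by
  letI : Algebra A B := φ.toRingHom.toAlgebra
  letI : IsScalarTower R A B := IsScalarTower.of_algebraMap_eq' <| IsScalarTower.algebraMap_eq R A B
  rw [Module.Grassmannian.map_toSubmodule]
  change LinearMap.ker (N.toSubmodule.mkQ.baseChange B ∘ₗ
    (AlgebraTensorModule.cancelBaseChange R A B B M).symm.toLinearMap) = _
  rw [LinearMap.ker_comp, ← Submodule.map_equiv_eq_comap_symm, ker_mkQ_baseChange_eq_baseChange,
    Submodule.baseChange_eq_span, Submodule.map_span, Submodule.map_coe, ← Set.image_comp]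
  congr 1
  refine Set.image_congr fun x hx => ?_
  clear hx
  rw [Function.comp_apply, TensorProduct.mk_apply, LinearEquiv.coe_coe, cancelBaseChange_one_tmul]
  -- `φ ⊗ 1` in its two spellings
  induction x using TensorProduct.induction_on with
  | zero => simp
  | tmul a m => rfl
  | add x y hx hy => rw [map_add, map_add, hx, hy]

/-! ## §3 Along a localization, `map` is `Submodule.localized'` -/

variable [Algebra A B] [IsScalarTower R A B]

/-- The base change `φ ⊗ 1` of the structure map, as an `A`-linear map, restricts to the `R`-linear `φ ⊗ 1`. [folklore] -/
private theorem rTensor_toAlgHom_apply (x : A ⊗[R] M) :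
    (IsScalarTower.toAlgHom R A B).toLinearMap.rTensor M x = AlgebraTensorModule.rTensor R M (Algebra.linearMap A B) x := by
  induction x using TensorProduct.induction_on with
  | zero => simp
  | tmul a m => rfl
  | add x y hx hy => rw [map_add, map_add, hx, hy]

/-- **`(map φ N).toSubmodule = N.localized'`** when `B` is the localization of `A` at a submonoid `S` (`φ` the structure map):
the base change `φ ⊗ 1 : A ⊗[R] M → B ⊗[R] M` is a localization of `A`-modules at `S` (Mathlib `IsLocalizedModule.rTensor`) and
the `B`-span of the image of `N` is `N.localized'` (Mathlib `Submodule.localized'_eq_span`).  This is the dictionary between the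
Grassmannian functor and Mathlib's local-global API for submodules (★ `GrassmannianZariskiSheaf`, Mathlib
`Submodule.eq_of_isLocalized'_span`). [cite: GortzWedhorn2020, Thm. 7.12 (p. 185) with Cor. 7.17 (p. 188), (8.4) (pp. 213–215) and (8.6) (p. 217)]
[cite: StacksProject, Tag 00EO] -/
theorem map_toSubmodule_eq_localized' (S : Submonoid A) [IsLocalization S B] (N : Module.Grassmannian A (A ⊗[R] M) k) :
    (Module.Grassmannian.map (IsScalarTower.toAlgHom R A B) N).toSubmodule =
      N.toSubmodule.localized' B S (AlgebraTensorModule.rTensor R M (Algebra.linearMap A B)) := by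
  rw [map_toSubmodule_eq_span, Submodule.localized'_eq_span]
  exact congrArg _ (Set.image_congr fun x _ => rTensor_toAlgHom_apply x)

end Map

end Literature.AlgebraicGeometry.Motives.Grassmannian
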